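import Summits.BirchSwinnertonDyer.BirchSwinnertonDyer.Theorems.RamifiedSevenEllipticUnitsSevenDivision
import Summits.BirchSwinnertonDyer.BirchSwinnertonDyer.Theorems.RamifiedSevenEllipticUnitsSevenDivisionB
import Summits.BirchSwinnertonDyer.BirchSwinnertonDyer.Theses.RamifiedSevenEllipticUnits
import Summits.BirchSwinnertonDyer.Rank1Residual.X12.O11.RamifiedStrictDescent
import Summits.BirchSwinnertonDyer.Rank1Residual.X12.CMSevenAwayFromSeven
import Summits.BirchSwinnertonDyer.Rank1Residual.X12.CMTwoTorsion
import Literature.NumberTheory.EllipticCurves.QuadraticTwistJInvariantProofs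
import Literature.NumberTheory.EllipticCurves.VariableChangePoints
import Literature.NumberTheory.EllipticCurves.VariableChangePointsMap
import Literature.NumberTheory.EllipticCurves.TorsionCardinality
import Literature.NumberTheory.EllipticCurves.ComplexMultiplicationDeuringLocalPlaces
import Mathlib.NumberTheory.RamificationInertia.Valuation
import HarnessLib

set_option linter.dupNamespace false
set_option autoImplicit false

/-!
# Route `RamifiedSevenEllipticUnits` (rung K7r): **(A𝔭) `W(K_𝔭)[7] = 0`** for every curve with CM
# field `ℚ(√−7)`, at every prime `𝔭 ∣ 7` of ramification index `≤ 2` of any number field — the local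
# input of cruxes #3 `StrictTorsionSeven` (stmt-BirchSwinnertonDyer-19144) and #4 `StrictControlSeven` (19145)

Cell `bsd-cm`, seat `bsd-cm-k7r-c3` (D-0074). HONEST FRAMING: nothing here closes a crux; this
discharges ONE displayed hypothesis of the cruxes' reductions (k7r-c4's
`RamifiedSevenEllipticUnitsStrictControlExactControl`, this seat's `…StrictTorsionOfControl`):
"`E(K_𝔭)[7] = 0`", which is Burungale–Kobayashi–Nakamura–Ota (3.16) (`H⁰(K^ac_{∞,𝔭}, E[p^∞]) = 0`)
read at the bottom of the tower (pro-`p` descent does the rest, `fixedPoints_decomp_inf_kerSubgroup_eq_bot_of_noPTorsion`).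

## The argument (elementary; no Galois representation, no reduction theory)

A curve `W/ℚ` with `cmFieldDiscrOfJ W.j = −7` has `j(W) ∈ {−3375, 255³}`
(`X12.j_eq_of_cmFieldDiscrOfJ_eq_neg_seven`), so it is `ℚ`-isomorphic to a quadratic twist
`y² = x³ + A d² x + B d³` of `y² = x³ − 35x − 98` or of `y² = x³ − 595x − 5586`
(`exists_variableChange_eq_quadraticTwist_of_j_eq'`, Silverman X.5.4). Over any field `F ⊇ ℚ` a
point `P ≠ O` with `7P = O` on that twist has `ψ₇(x(P))² = 0` (`zsmul_some_eq_zero_iff_eval_ΨSq`,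
Silverman Ex. 3.7), and `ψ₇` of these twists has NO root in `F` as soon as `F` carries a valuation
`v` with `exp(−2) ≤ v(7) < 1`, `v(ℤ) ≤ 1` and `v(m₀) = 1` for the two unit parts `m₀` of the constant
coefficients (`SevenDivision.eval_preΨ'_seven_twist35_ne_zero`, `…twist595_ne_zero`: the `7`-adic
Newton polygon of `ψ₇` has slopes `1/3`, `10/21`, none in `½ℤ`). For `F = K_𝔭`, the completion of a
number field at a prime `𝔭 ∋ 7` with `v_𝔭(7) ≤ 2` — e.g. THE prime above `7` of the CM field
`K = ℚ(√−7)`, where `(7) = 𝔭²` — all four conditions hold (`m₀ ∉ 𝔭` by an explicit Bézout identity).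

* `seven_nsmul_eq_zero_of_valuation` — the statement over an abstract valued field `(F, v)`;
* `seven_nsmul_adicCompletion_eq_zero` — at `K_𝔭` for any number field `K`, `7 ∈ 𝔭`, `v_𝔭(7) ≤ 2`;
* `exp_neg_two_le_intValuation_seven` — `v_𝔭(7) ≤ 2` for EVERY prime `𝔭 ∋ 7` of EVERY quadratic
  number field (Mathlib's `intValuation_liesOver`: `v_𝔭(7) = e(𝔭|7) · v_7(7)`, and `e(𝔭|7) ≤ 2` from the
  tree's `placesOver_trichotomy_of_finrank_eq_two`);
* `seven_nsmul_adicCompletion_eq_zero_of_finrank_eq_two`, **`seven_nsmul_adicCompletion_eq_zero_of_isFrame`**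
  — hence UNCONDITIONALLY at every O11 frame `(K, 𝔭, W', C)` of a `W ∈ 𝒞₇`, in the exact binder
  shape `(A𝔭)` of the two crux reductions.

References: [SilvermanAEC2009] Exercise 3.7, X.5 Prop. 5.4 / Cor. 5.4.1, VII.3;
[BurungaleKobayashiNakamuraOta2026] (3.16) (arXiv:2608.06879; the statement served, nothing used).
-/

noncomputable section

open scoped Classical

open WeierstrassCurve Polynomial WithZero NumberField IsDedekindDomain

namespace Summit.BirchSwinnertonDyer.BirchSwinnertonDyer.Theorems.RamifiedSevenEllipticUnits.SevenTorsion

open SevenDivision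

/-! ## §1 No `7`-torsion on the twists, over an abstract valued field -/

section Valued

variable {F : Type*} [Field F] (v : Valuation F ℤᵐ⁰)

/-- No point `P ≠ O` with `7P = O` on `y² = x³ − 35d²x − 98d³` (`d ≠ 0`) over a valued field with
`exp(−2) ≤ v 7 < 1`, `v(ℤ) ≤ 1`, `v(4619410991) = 1`: `ψ₇(x(P))² = 0` would contradict
`eval_preΨ'_seven_twist35_ne_zero`. [cite: SilvermanAEC2009, Exercise 3.7(f)] -/
theorem zsmul_seven_eq_zero_twist35 (h71 : v (7 : F) < 1) (h72 : exp (-2) ≤ v (7 : F))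
    (hint : ∀ n : ℤ, v ((n : ℤ) : F) ≤ 1) (hm₀ : v ((4619410991 : ℤ) : F) = 1) {d : F} (hd : d ≠ 0)
    (P : (⟨0, 0, 0, (-35) * d ^ 2, (-98) * d ^ 3⟩ : WeierstrassCurve F).toAffine.Point)
    (hP : (7 : ℤ) • P = 0) : P = 0 := by
  rcases P with _ | ⟨x, y, hxy⟩
  · rfl
  · exfalso
    have h := (zsmul_some_eq_zero_iff_eval_ΨSq _ hxy 7).mp hP
    rw [show (7 : ℤ) = ((7 : ℕ) : ℤ) from rfl, ΨSq_ofNat, if_neg (by decide), mul_one, eval_pow,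
      pow_eq_zero_iff two_ne_zero] at h
    exact eval_preΨ'_seven_twist35_ne_zero v h71 h72 hint hm₀ hd x h

/-- The same for `y² = x³ − 595d²x − 5586d³` (`v(−368129040996985381009) = 1`).
[cite: SilvermanAEC2009, Exercise 3.7(f)] -/
theorem zsmul_seven_eq_zero_twist595 (h71 : v (7 : F) < 1) (h72 : exp (-2) ≤ v (7 : F))
    (hint : ∀ n : ℤ, v ((n : ℤ) : F) ≤ 1) (hm₀ : v ((-368129040996985381009 : ℤ) : F) = 1) {d : F}
    (hd : d ≠ 0)
    (P : (⟨0, 0, 0, (-595) * d ^ 2, (-5586) * d ^ 3⟩ : WeierstrassCurve F).toAffine.Point)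
    (hP : (7 : ℤ) • P = 0) : P = 0 := by
  rcases P with _ | ⟨x, y, hxy⟩
  · rfl
  · exfalso
    have h := (zsmul_some_eq_zero_iff_eval_ΨSq _ hxy 7).mp hP
    rw [show (7 : ℤ) = ((7 : ℕ) : ℤ) from rfl, ΨSq_ofNat, if_neg (by decide), mul_one, eval_pow,
      pow_eq_zero_iff two_ne_zero] at h
    exact eval_preΨ'_seven_twist595_ne_zero v h71 h72 hint hm₀ hd x h

/-- **No `7`-torsion over a valued field with `e(7) ≤ 2`, for every curve with `j ∈ {−3375, 255³}`.**
For `W/ℚ` elliptic with `j(W) = −3375` or `j(W) = 16581375`, any field `F` with a ring map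
`φ : ℚ → F` and a valuation `v` with `exp(−2) ≤ v 7 < 1`, `v(ℤ) ≤ 1`, `v(m₀) = 1` for both unit parts:
every `P ∈ W(F)` with `7P = O` is `O`. Transport along the `ℚ`-isomorphism `C • W = E₀^{(d)}`
(`exists_variableChange_eq_quadraticTwist_of_j_eq'`; `VariableChange.pointEquiv`) to the explicit twist.
[cite: SilvermanAEC2009, X.5 Prop. 5.4 and Cor. 5.4.1] -/
theorem seven_nsmul_eq_zero_of_valuation (h71 : v (7 : F) < 1) (h72 : exp (-2) ≤ v (7 : F))
    (hint : ∀ n : ℤ, v ((n : ℤ) : F) ≤ 1) (hm₁ : v ((4619410991 : ℤ) : F) = 1)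
    (hm₂ : v ((-368129040996985381009 : ℤ) : F) = 1)
    (W : WeierstrassCurve ℚ) [W.IsElliptic] (hj : W.j = -3375 ∨ W.j = 16581375) (φ : ℚ →+* F)
    (R : (W.map φ).toAffine.Point) (hR : 7 • R = 0) : R = 0 := by
  have hR' : (7 : ℤ) • R = 0 := by rw [show (7 : ℤ) = ((7 : ℕ) : ℤ) from rfl, natCast_zsmul]; exact hR
  rcases hj with hj | hj
  · -- reference curve `y² = x³ − 35x − 98`, `j = −3375`
    let E : WeierstrassCurve ℚ := ⟨0, 0, 0, -35, -98⟩
    have hΔ : E.Δ = -1404928 := by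
      norm_num [E, WeierstrassCurve.Δ, WeierstrassCurve.b₂, WeierstrassCurve.b₄,
        WeierstrassCurve.b₆, WeierstrassCurve.b₈]
    haveI : E.IsElliptic := by rw [WeierstrassCurve.isElliptic_iff, hΔ]; norm_num
    have hjE : E.j = -3375 := by
      rw [WeierstrassCurve.j, Units.val_inv_eq_inv_val, WeierstrassCurve.coe_Δ', hΔ]
      norm_num [E, WeierstrassCurve.c₄, WeierstrassCurve.b₂, WeierstrassCurve.b₄]
    obtain ⟨d, hd, C, hC⟩ := exists_variableChange_eq_quadraticTwist_of_j_eq' (W := W) (E := E)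
      (by rw [hj, hjE]) (by rw [hj]; norm_num) (by rw [hj]; norm_num)
    have hTq : E.quadraticTwist d = ⟨0, 0, 0, (-35) * d ^ 2, (-98) * d ^ 3⟩ := by
      ext <;> simp [E, quadraticTwist, WeierstrassCurve.b₂, WeierstrassCurve.b₄,
        WeierstrassCurve.b₆] <;> ring
    have hT : (C.map φ) • (W.map φ) =
        (⟨0, 0, 0, (-35) * (φ d) ^ 2, (-98) * (φ d) ^ 3⟩ : WeierstrassCurve F) := by
      rw [map_variableChange, hC, hTq]
      ext <;> simp [WeierstrassCurve.map, map_neg, map_mul, map_pow, map_ofNat]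
    let e := (VariableChange.pointEquiv (W.map φ) (C.map φ)).trans (Affine.Point.congrEquiv hT)
    have hP := zsmul_seven_eq_zero_twist35 v h71 h72 hint hm₁ ((map_ne_zero φ).mpr hd) (e R)
      (by rw [← map_zsmul, hR', map_zero])
    exact (AddEquiv.map_eq_zero_iff e).mp hP
  · -- reference curve `y² = x³ − 595x − 5586`, `j = 255³`
    let E : WeierstrassCurve ℚ := ⟨0, 0, 0, -595, -5586⟩
    have hΔ : E.Δ = 1404928 := by
      norm_num [E, WeierstrassCurve.Δ, WeierstrassCurve.b₂, WeierstrassCurve.b₄,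
        WeierstrassCurve.b₆, WeierstrassCurve.b₈]
    haveI : E.IsElliptic := by rw [WeierstrassCurve.isElliptic_iff, hΔ]; norm_num
    have hjE : E.j = 16581375 := by
      rw [WeierstrassCurve.j, Units.val_inv_eq_inv_val, WeierstrassCurve.coe_Δ', hΔ]
      norm_num [E, WeierstrassCurve.c₄, WeierstrassCurve.b₂, WeierstrassCurve.b₄]
    obtain ⟨d, hd, C, hC⟩ := exists_variableChange_eq_quadraticTwist_of_j_eq' (W := W) (E := E)
      (by rw [hj, hjE]) (by rw [hj]; norm_num) (by rw [hj]; norm_num)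
    have hTq : E.quadraticTwist d = ⟨0, 0, 0, (-595) * d ^ 2, (-5586) * d ^ 3⟩ := by
      ext <;> simp [E, quadraticTwist, WeierstrassCurve.b₂, WeierstrassCurve.b₄,
        WeierstrassCurve.b₆] <;> ring
    have hT : (C.map φ) • (W.map φ) =
        (⟨0, 0, 0, (-595) * (φ d) ^ 2, (-5586) * (φ d) ^ 3⟩ : WeierstrassCurve F) := by
      rw [map_variableChange, hC, hTq]
      ext <;> simp [WeierstrassCurve.map, map_neg, map_mul, map_pow, map_ofNat]
    let e := (VariableChange.pointEquiv (W.map φ) (C.map φ)).trans (Affine.Point.congrEquiv hT)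
    have hP := zsmul_seven_eq_zero_twist595 v h71 h72 hint hm₂ ((map_ne_zero φ).mpr hd) (e R)
      (by rw [← map_zsmul, hR', map_zero])
    exact (AddEquiv.map_eq_zero_iff e).mp hP

end Valued

/-! ## §2 At the completion `K_𝔭` of a number field at a prime `𝔭 ∋ 7` with `v_𝔭(7) ≤ 2` -/

section Completion

open IsDedekindDomain.HeightOneSpectrum

variable {K : Type} [Field K] [NumberField K] (𝔭 : HeightOneSpectrum (𝓞 K))

/-- The valuation of `K_𝔭` on an integer `n ∈ ℤ ⊂ 𝓞 K` is the `𝔭`-adic valuation of `(n : 𝓞 K)`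
(in particular `≤ 1`). [folklore] -/
theorem valued_adicCompletion_intCast (n : ℤ) :
    Valued.v ((n : ℤ) : 𝔭.adicCompletion K) = 𝔭.intValuation (n : 𝓞 K) := by
  have h1 : Valued.v (algebraMap (𝓞 K) (𝔭.adicCompletion K) (n : 𝓞 K)) =
      𝔭.valuation K (algebraMap (𝓞 K) K (n : 𝓞 K)) :=
    valuedAdicCompletion_eq_valuation (K := K) 𝔭 (n : 𝓞 K)
  have h2 : 𝔭.valuation K (algebraMap (𝓞 K) K (n : 𝓞 K)) = 𝔭.intValuation (n : 𝓞 K) :=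
    valuation_of_algebraMap (K := K) 𝔭 (n : 𝓞 K)
  rw [map_intCast (algebraMap (𝓞 K) (𝔭.adicCompletion K)), map_intCast (algebraMap (𝓞 K) K)] at h1
  rw [map_intCast (algebraMap (𝓞 K) K)] at h2
  rw [h1, h2]

/-- An integer prime to `7` is a `𝔭`-adic unit when `7 ∈ 𝔭`: from a Bézout identity
`7b − m = 1`, `m ∈ 𝔭` would give `1 ∈ 𝔭`. [folklore] -/
theorem intValuation_eq_one_of_bezout (h7 : (7 : 𝓞 K) ∈ 𝔭.asIdeal) {m b : ℤ}
    (hbez : 7 * b - m = 1) : 𝔭.intValuation (m : 𝓞 K) = 1 := by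
  rw [intValuation_eq_one_iff_mem_primeCompl]
  intro hm
  apply 𝔭.isPrime.ne_top
  rw [Ideal.eq_top_iff_one]
  have e : (1 : 𝓞 K) = 7 * (b : 𝓞 K) - (m : 𝓞 K) := by exact_mod_cast congrArg (Int.cast (R := 𝓞 K)) hbez.symm
  rw [e]
  exact Ideal.sub_mem _ (Ideal.mul_mem_right _ _ h7) hm

/-- `7` is a prime element of `𝓞 ℚ ≅ ℤ`. [folklore] -/
theorem prime_seven_ringOfIntegers : Prime (7 : 𝓞 ℚ) := by
  have h : Prime ((Rat.ringOfIntegersEquiv : 𝓞 ℚ ≃+* ℤ) 7) := by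
    rw [map_ofNat]
    exact Int.prime_iff_natAbs_prime.mpr (by norm_num)
  exact (MulEquiv.prime_iff (Rat.ringOfIntegersEquiv : 𝓞 ℚ ≃+* ℤ).toMulEquiv).mp h

/-- A height-one prime of `𝓞 ℚ` containing `7` is `(7)` (nonzero primes of `𝓞 ℚ` are maximal).
[folklore] -/
theorem asIdeal_eq_span_seven (v : HeightOneSpectrum (𝓞 ℚ)) (h7 : (7 : 𝓞 ℚ) ∈ v.asIdeal) :
    v.asIdeal = Ideal.span {(7 : 𝓞 ℚ)} := by
  have hp : (Ideal.span {(7 : 𝓞 ℚ)}).IsPrime :=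
    (Ideal.span_singleton_prime prime_seven_ringOfIntegers.ne_zero).mpr prime_seven_ringOfIntegers
  have hne : Ideal.span {(7 : 𝓞 ℚ)} ≠ ⊥ := by
    rw [Ne, Ideal.span_singleton_eq_bot]; exact prime_seven_ringOfIntegers.ne_zero
  haveI hmax : (Ideal.span {(7 : 𝓞 ℚ)}).IsMaximal := hp.isMaximal hne
  exact (hmax.eq_of_le v.isPrime.ne_top ((Ideal.span_singleton_le_iff_mem _).mpr h7)).symm

/-- **`v_𝔭(7) ≤ 2` in a quadratic field**: for `[K : ℚ] = 2` and a prime `𝔭 ∋ 7` of `𝓞 K`,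
`exp (−2) ≤ 𝔭.intValuation 7`, i.e. `𝔭³ ∤ (7)`. Indeed `v_𝔭(7) = v_{(7)}(7)^{e(𝔭|7)} = exp(−e)`
(Mathlib `intValuation_liesOver` over the place `(7)` of `𝓞 ℚ` below `𝔭`) and `e(𝔭|7) ∈ {1, 2}` by the
fundamental identity `Σ eᵢfᵢ = 2` (the tree's `placesOver_trichotomy_of_finrank_eq_two`). For
`K = ℚ(√−7)`: `(7) = 𝔭²`, `v_𝔭(7) = exp(−2)` exactly. [cite: NeukirchANT1999, Ch. I §8 Prop. (8.2) (fundamental identity)] -/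
theorem exp_neg_two_le_intValuation_seven (hK : Module.finrank ℚ K = 2)
    (h7 : (7 : 𝓞 K) ∈ 𝔭.asIdeal) : exp (-2) ≤ 𝔭.intValuation (7 : 𝓞 K) := by
  let v : HeightOneSpectrum (𝓞 ℚ) := 𝔭.under (𝓞 ℚ)
  haveI : 𝔭.asIdeal.LiesOver v.asIdeal := ⟨rfl⟩
  have h7v : (7 : 𝓞 ℚ) ∈ v.asIdeal := by
    change (7 : 𝓞 ℚ) ∈ Ideal.comap (algebraMap (𝓞 ℚ) (𝓞 K)) 𝔭.asIdeal
    rw [Ideal.mem_comap, map_ofNat]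
    exact h7
  have hv7 : v.intValuation (7 : 𝓞 ℚ) = exp (-1) :=
    intValuation_singleton v prime_seven_ringOfIntegers.ne_zero (asIdeal_eq_span_seven v h7v)
  have hid := intValuation_liesOver v 𝔭 (7 : 𝓞 ℚ)
  rw [map_ofNat (algebraMap (𝓞 ℚ) (𝓞 K)) 7, hv7] at hid
  -- the exponent is `e(𝔭|7) ≤ 2`
  have he : v.asIdeal.ramificationIdx' 𝔭.asIdeal ≤ 2 := by
    rw [Ideal.ramificationIdx'_eq_ramificationIdx v.asIdeal 𝔭.asIdeal v.ne_bot]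
    rcases Literature.NumberTheory.EllipticCurves.placesOver_trichotomy_of_finrank_eq_two K hK v with
      ⟨w₁, w₂, -, -, hef⟩ | ⟨w, hw, he, -⟩ | ⟨w, hw, he, -⟩
    · exact ((hef 𝔭 rfl).1).le.trans one_le_two
    · have : 𝔭 = w := by
        have hmem : 𝔭 ∈ ({w' : HeightOneSpectrum (𝓞 K) | w'.under (𝓞 ℚ) = v} : Set _) := rfl
        rw [hw] at hmem
        exact hmem
      rw [this, he]; exact one_le_two
    · have : 𝔭 = w := by
        have hmem : 𝔭 ∈ ({w' : HeightOneSpectrum (𝓞 K) | w'.under (𝓞 ℚ) = v} : Set _) := rfl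
        rw [hw] at hmem
        exact hmem
      rw [this, he]
  rw [← hid]
  interval_cases v.asIdeal.ramificationIdx' 𝔭.asIdeal
  · rw [pow_zero, ← exp_zero, exp_le_exp]; omega
  · rw [pow_one, exp_le_exp]; omega
  · rw [pow_two, ← exp_add, exp_le_exp]; omega

/-- **(A𝔭) at a completion: `W(K_𝔭)[7] = 0`.** For `W/ℚ` elliptic with CM field `ℚ(√−7)`
(`cmFieldDiscrOfJ W.j = −7`), a number field `K`, a prime `𝔭 ∋ 7` of `𝓞 K` with `v_𝔭(7) ≤ 2`
(`exp(−2) ≤ v_𝔭(7)`; e.g. `K = ℚ(√−7)`, `(7) = 𝔭²`): every point `R` of `W` over `K_𝔭` with `7R = O`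
is `O`. [cite: SilvermanAEC2009, Exercise 3.7 and X.5 Prop. 5.4] [cite: BurungaleKobayashiNakamuraOta2026, (3.16) (arXiv:2608.06879; shape only)] -/
theorem seven_nsmul_adicCompletion_eq_zero (W : WeierstrassCurve ℚ) [W.IsElliptic]
    (hj : Literature.NumberTheory.EllipticCurves.Rank1Residual.cmFieldDiscrOfJ W.j = -7)
    (h7 : (7 : 𝓞 K) ∈ 𝔭.asIdeal) (he : exp (-2) ≤ 𝔭.intValuation (7 : 𝓞 K))
    (R : ((W.baseChange K).baseChange (𝔭.adicCompletion K)).toAffine.Point) (hR : 7 • R = 0) :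
    R = 0 := by
  set F := 𝔭.adicCompletion K
  have h7v : Valued.v (7 : F) = 𝔭.intValuation (7 : 𝓞 K) := by
    have := valued_adicCompletion_intCast 𝔭 7
    push_cast at this
    exact this
  have h71 : Valued.v (7 : F) < 1 := by
    rw [h7v]; exact (intValuation_lt_one_iff_mem 𝔭 _).mpr h7
  have h72 : exp (-2) ≤ Valued.v (7 : F) := by rw [h7v]; exact he
  have hint : ∀ n : ℤ, Valued.v ((n : ℤ) : F) ≤ 1 := fun n ↦ by
    rw [valued_adicCompletion_intCast]; exact intValuation_le_one 𝔭 _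
  have hm₁ : Valued.v ((4619410991 : ℤ) : F) = 1 := by
    rw [valued_adicCompletion_intCast]
    exact intValuation_eq_one_of_bezout 𝔭 h7 (b := 659915856) (by norm_num)
  have hm₂ : Valued.v ((-368129040996985381009 : ℤ) : F) = 1 := by
    rw [valued_adicCompletion_intCast]
    exact intValuation_eq_one_of_bezout 𝔭 h7 (b := -52589862999569340144) (by norm_num)
  have hWF : (W.baseChange K).baseChange F = W.map ((algebraMap K F).comp (algebraMap ℚ K)) := by
    rw [WeierstrassCurve.baseChange, WeierstrassCurve.baseChange, WeierstrassCurve.map_map]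
  have hR' : 7 • Affine.Point.congrEquiv hWF R = 0 := by rw [← map_nsmul, hR, map_zero]
  have := seven_nsmul_eq_zero_of_valuation Valued.v h71 h72 hint hm₁ hm₂ W
    (Summit.BirchSwinnertonDyer.Rank1Residual.X12.j_eq_of_cmFieldDiscrOfJ_eq_neg_seven hj)
    ((algebraMap K F).comp (algebraMap ℚ K)) (Affine.Point.congrEquiv hWF R) hR'
  simpa using this

/-- **(A𝔭) at a completion of a QUADRATIC field, unconditionally**: for `[K : ℚ] = 2` the input
`v_𝔭(7) ≤ 2` holds (`exp_neg_two_le_intValuation_seven`). [cite: SilvermanAEC2009, Exercise 3.7 and X.5 Prop. 5.4] -/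
theorem seven_nsmul_adicCompletion_eq_zero_of_finrank_eq_two (W : WeierstrassCurve ℚ) [W.IsElliptic]
    (hj : Literature.NumberTheory.EllipticCurves.Rank1Residual.cmFieldDiscrOfJ W.j = -7)
    (hK : Module.finrank ℚ K = 2) (h7 : (7 : 𝓞 K) ∈ 𝔭.asIdeal)
    (R : ((W.baseChange K).baseChange (𝔭.adicCompletion K)).toAffine.Point) (hR : 7 • R = 0) :
    R = 0 :=
  seven_nsmul_adicCompletion_eq_zero 𝔭 W hj h7 (exp_neg_two_le_intValuation_seven 𝔭 hK h7) R hR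

end Completion

/-! ## §3 At the O11 frames of the class 𝒞₇ (the binder shape of the crux reductions) -/

section Frame

open Summit.BirchSwinnertonDyer.Rank1Residual

/-- **(A𝔭) at every O11 frame of every `W ∈ 𝒞₇` — unconditionally.** In the binder shape of
`strictTorsionSeven_of_noPTorsion_of_finite_base` (this seat) and of k7r-c4's
`strictControl_frame_natCard_eq` / `controlMap_bijective_of_noPTorsion`: for `W ∈ 𝒞₇`
(`ClassCSeven W`: `cmFieldDiscrOfJ W.j = −7`) and a frame `(K, 𝔭, W', C)` of `(W, 7)` (`K` imaginary
quadratic, `7 ∈ 𝔭`), `W(K_𝔭)[7] = 0`. This is BKNO (3.16) read at the bottom of the anticyclotomic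
tower, now a theorem of the tree for the class 𝒞₇.
[cite: SilvermanAEC2009, Exercise 3.7 and X.5 Prop. 5.4] [cite: BurungaleKobayashiNakamuraOta2026, (3.16) (arXiv:2608.06879; shape only)] -/
theorem seven_nsmul_adicCompletion_eq_zero_of_isFrame (W : WeierstrassCurve ℚ) [W.IsElliptic]
    [W.IsGloballyMinimal] (hC7 : X12.ClassCSeven W)
    {K : Type} [Field K] [NumberField K] (𝔭 : HeightOneSpectrum (𝓞 K))
    (W' : WeierstrassCurve ℚ) [W'.IsElliptic] [W'.IsGloballyMinimal] (C : VariableChange ℚ)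
    (hF : X12.O11.IsFrame W 7 K 𝔭 W' C) :
    ∀ R : ((W.baseChange K).baseChange (𝔭.adicCompletion K)).toAffine.Point, 7 • R = 0 → R = 0 := by
  intro R hR
  have h7 : (7 : 𝓞 K) ∈ 𝔭.asIdeal := by
    have h := hF.2.2.2.2.2.1
    exact_mod_cast h
  exact seven_nsmul_adicCompletion_eq_zero_of_finrank_eq_two 𝔭 W hC7.2.1 hF.2.2.2.1.1 h7 R hR

end Frame

end Summit.BirchSwinnertonDyer.BirchSwinnertonDyer.Theorems.RamifiedSevenEllipticUnits.SevenTorsion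

end
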